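import Literature.Probability.Percolation.Percolation
import Mathlib.Analysis.SpecialFunctions.Pow.Real
import HarnessLib

/-!
# The uniqueness critical value `p_u`, the (vertex) Cheeger constant `h(G)` and the isoperimetric
# dimension `Dim(G)` (Benjamini–Schramm 1996, §§2–3; Heydenreich–van der Hofstad 2017, §15.6)

Topic `Literature/Probability/Percolation`.  DEFINITIONS ONLY (no named facts), in the tree's percolation vocabulary
(`Percolation.lean`: `bondPercolation`, `numInfiniteClusters`, `sitePercolation`, `siteOpenGraph`, `criticalProb`,
`siteCriticalProb`; `LatticeGraph.lean`: `outerBoundary`), for the percolation questions "beyond `ℤ^d`" of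
Benjamini–Schramm 1996 (their Questions 2–3 and Conjecture 6 are typed, as open obligations, under
`Summits/CriticalPhenomena/PercolationContinuityZ3/Theorems/`).

* `siteNumInfiniteClusters G ω` — the number of infinite open SITE clusters (site analogue of the tree's bond
  `numInfiniteClusters`).
* `uniquenessProb G` / `siteUniquenessProb G` — **`p_u = inf {p : P_p(there is exactly one infinite open cluster) = 1}`**
  (Benjamini–Schramm 1996, §2, p. 73; Heydenreich–van der Hofstad 2017, (15.6.4)), bond / site, with the same `∪ {1}`
  convention as the tree's `criticalProb` (so `p_u ∈ [0,1]`, and `p_u = 1` when no `p` gives a.s. uniqueness — e.g. on a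
  finite graph; on an infinite connected graph `p = 1` already lies in the set, so the convention changes nothing there).
* `vertexCheegerConst G` — **`h(G) = inf {|∂S| / |S| : S finite nonempty}`**, `∂S` = the vertices outside `S` with a
  neighbour in `S` (the tree's `outerBoundary G S`) (Benjamini–Schramm 1996, §2, p. 73).  (Heydenreich–van der Hofstad
  (15.6.2) and Lyons–Peres §6.1 use the EDGE boundary; for bounded degree the two constants vanish together.)
* `IsoperimetricInequality G d` — "`|∂S| ≥ c |S|^{(d-1)/d}` for all finite nonempty `S`, some `c > 0`", and
  `isoperimetricDimension G = Dim(G) = sup {d > 0 : inf_S |∂S| / |S|^{(d-1)/d} > 0}` as an extended real in `[0, ∞]`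
  (Benjamini–Schramm 1996, §3, p. 74; Duminil-Copin–Goswami–Raoufi–Severo–Yadin 2020, (I_d)).

API (all proved): `uniquenessProb_mem_Icc`, `siteUniquenessProb_mem_Icc`, `vertexCheegerConst_nonneg`,
`vertexCheegerConst_le`, `vertexCheegerConst_pos_iff` (`h(G) > 0 ↔ ∃ c > 0, ∀ S, c|S| ≤ |∂S|`, on a nonempty vertex
type), `IsoperimetricInequality.of_le` (monotonicity in the dimension), `one_lt_isoperimetricDimension_iff`
(`Dim(G) > 1 ↔` some `d > 1` satisfies the inequality — the form in which Benjamini–Schramm's Question 2 is typed).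

Junk values, documented: `vertexCheegerConst G = 0` on an empty vertex type (`sInf ∅ = 0` in `ℝ`);
`isoperimetricDimension G = 0` when no `d > 0` qualifies (e.g. finite graphs: `S = univ` has empty boundary).

References: I. Benjamini, O. Schramm, *Percolation beyond `ℤ^d`, many questions and a few answers*, Electron. Comm.
Probab. 1 (1996) 71–82, §§2–3 [BenjaminiSchramm1996]; M. Heydenreich, R. van der Hofstad, *Progress in
High-Dimensional Percolation and Random Graphs* (2017), §15.6, (15.6.2), (15.6.4) [HeydenreichVanDerHofstad2017];
H. Duminil-Copin, S. Goswami, A. Raoufi, F. Severo, A. Yadin, Duke Math. J. 169 (2020), §1 (I_d) and Thm. 1.2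
[DuminilCopinGoswamiRaoufiSeveroYadin2020]; R. Lyons, Y. Peres, *Probability on Trees and Networks* (2016), §6.1,
§7.6–7.7 [LyonsPeres2016].
-/

noncomputable section

open MeasureTheory Set
open scoped ENNReal

namespace Literature.Probability.Percolation

open Literature.Probability.LatticeModels (outerBoundary mem_outerBoundary_iff)

variable {V : Type*}

/-! ### Number of infinite site clusters; the uniqueness critical value `p_u` (bond and site) -/

/-- The number of infinite open SITE clusters of the site configuration `ω` on `G`: the infinite connected
components of the open subgraph `siteOpenGraph G ω` (a closed vertex is isolated there, so every infinite component
consists of open vertices and is an infinite open site cluster).  Site analogue of the tree's `numInfiniteClusters`.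
[cite: BenjaminiSchramm1996, §2 (p. 72–73: uniqueness of the infinite open cluster; site percolation throughout)] -/
def siteNumInfiniteClusters (G : SimpleGraph V) (ω : SiteConfig V) : ℕ∞ :=
  {C : (siteOpenGraph G ω).ConnectedComponent | C.supp.Infinite}.encard

/-- **The uniqueness critical value `p_u` (bond percolation)**:
`p_u(G) = inf {p : P_p(there is exactly one infinite open cluster) = 1}`, the infimum taken over
`{p ∈ [0,1] | P_p-a.s. numInfiniteClusters = 1} ∪ {1}` (the `∪ {1}` is the tree's `criticalProb` convention: it puts
`p_u ∈ [0,1]` and gives `p_u = 1` when no parameter has an a.s. unique infinite cluster; on an infinite connected graph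
`p = 1` lies in the set anyway). [cite: BenjaminiSchramm1996, §2 (p. 73, definition of p_u)]
[cite: HeydenreichVanDerHofstad2017, (15.6.4)] -/
def uniquenessProb (G : SimpleGraph V) : ℝ :=
  sInf ({p : ℝ | ∃ h : p ∈ unitInterval, ∀ᵐ ω ∂(bondPercolation G ⟨p, h⟩), numInfiniteClusters ω = 1} ∪ {1})

/-- **The uniqueness critical value `p_u` (site percolation, Benjamini–Schramm's own setting)**:
`p_u(G) = inf {p : P_p(there is exactly one infinite open cluster) = 1}` for Bernoulli site percolation on `G`
(measure `sitePercolation V p`, clusters of `siteOpenGraph G ω`), with the same `∪ {1}` convention.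
[cite: BenjaminiSchramm1996, §2 (p. 73, definition of p_u; "Throughout the paper, site percolation is discussed")] -/
def siteUniquenessProb (G : SimpleGraph V) : ℝ :=
  sInf ({p : ℝ | ∃ h : p ∈ unitInterval, ∀ᵐ ω ∂(sitePercolation V ⟨p, h⟩), siteNumInfiniteClusters G ω = 1} ∪ {1})

/-- `0 ≤ p_u ≤ 1` (bond). [cite: BenjaminiSchramm1996, §2 (p. 73)] -/
theorem uniquenessProb_mem_Icc (G : SimpleGraph V) : uniquenessProb G ∈ Set.Icc (0 : ℝ) 1 := by
  have h0 : ∀ p ∈ ({p : ℝ | ∃ h : p ∈ unitInterval,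
      ∀ᵐ ω ∂(bondPercolation G ⟨p, h⟩), numInfiniteClusters ω = 1} ∪ {1}), 0 ≤ p := by
    rintro p (⟨h, -⟩ | h)
    · exact h.1
    · rw [Set.mem_singleton_iff] at h
      rw [h]; exact zero_le_one
  exact ⟨le_csInf ⟨1, Or.inr rfl⟩ h0, csInf_le ⟨0, h0⟩ (Or.inr rfl)⟩

/-- `0 ≤ p_u ≤ 1` (site). [cite: BenjaminiSchramm1996, §2 (p. 73)] -/
theorem siteUniquenessProb_mem_Icc (G : SimpleGraph V) : siteUniquenessProb G ∈ Set.Icc (0 : ℝ) 1 := by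
  have h0 : ∀ p ∈ ({p : ℝ | ∃ h : p ∈ unitInterval,
      ∀ᵐ ω ∂(sitePercolation V ⟨p, h⟩), siteNumInfiniteClusters G ω = 1} ∪ {1}), 0 ≤ p := by
    rintro p (⟨h, -⟩ | h)
    · exact h.1
    · rw [Set.mem_singleton_iff] at h
      rw [h]; exact zero_le_one
  exact ⟨le_csInf ⟨1, Or.inr rfl⟩ h0, csInf_le ⟨0, h0⟩ (Or.inr rfl)⟩

/-- If bond percolation at some `p ∈ [0,1]` has a.s. exactly one infinite cluster, then `p_u ≤ p` (immediate from the
definition of `p_u` as an infimum). [cite: BenjaminiSchramm1996, §2 (p. 73, definition of p_u)] -/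
theorem uniquenessProb_le (G : SimpleGraph V) (p : unitInterval)
    (h : ∀ᵐ ω ∂(bondPercolation G p), numInfiniteClusters ω = 1) : uniquenessProb G ≤ p := by
  refine csInf_le ⟨0, ?_⟩ (Or.inl ⟨p.2, h⟩)
  rintro q (⟨hq, -⟩ | hq)
  · exact hq.1
  · rw [Set.mem_singleton_iff] at hq
    rw [hq]; exact zero_le_one

/-- If site percolation at some `p ∈ [0,1]` has a.s. exactly one infinite cluster, then `p_u^{site} ≤ p` (immediate from
the definition of `p_u` as an infimum). [cite: BenjaminiSchramm1996, §2 (p. 73, definition of p_u)] -/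
theorem siteUniquenessProb_le (G : SimpleGraph V) (p : unitInterval)
    (h : ∀ᵐ ω ∂(sitePercolation V p), siteNumInfiniteClusters G ω = 1) : siteUniquenessProb G ≤ p := by
  refine csInf_le ⟨0, ?_⟩ (Or.inl ⟨p.2, h⟩)
  rintro q (⟨hq, -⟩ | hq)
  · exact hq.1
  · rw [Set.mem_singleton_iff] at hq
    rw [hq]; exact zero_le_one

/-! ### The (vertex) Cheeger constant `h(G)` -/

section Cheeger

variable [DecidableEq V] (G : SimpleGraph V) [G.LocallyFinite]

/-- **The Cheeger constant** of a locally finite graph, with the (outer) VERTEX boundary: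
`h(G) = inf { |∂S| / |S| : S a finite nonempty set of vertices }`, `∂S = {v ∉ S : v has a neighbour in S}`
(= the tree's `outerBoundary G S`).  Junk value: `0` on an empty vertex type (`sInf ∅ = 0`).
[cite: BenjaminiSchramm1996, §2 (p. 73, Cheeger's constant)] -/
def vertexCheegerConst : ℝ :=
  sInf ((fun S : Finset V => ((outerBoundary G S).card : ℝ) / (S.card : ℝ)) '' {S : Finset V | S.Nonempty})

/-- `0 ≤ h(G)` (an infimum of nonnegative ratios). [cite: BenjaminiSchramm1996, §2 (p. 73, Cheeger's constant)] -/
theorem vertexCheegerConst_nonneg : 0 ≤ vertexCheegerConst G := by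
  refine Real.sInf_nonneg ?_
  rintro _ ⟨S, -, rfl⟩
  positivity

/-- `h(G) ≤ |∂S| / |S|` for every finite nonempty `S`. [cite: BenjaminiSchramm1996, §2 (p. 73)] -/
theorem vertexCheegerConst_le {S : Finset V} (hS : S.Nonempty) :
    vertexCheegerConst G ≤ ((outerBoundary G S).card : ℝ) / (S.card : ℝ) := by
  refine csInf_le ⟨0, ?_⟩ ⟨S, hS, rfl⟩
  rintro _ ⟨T, -, rfl⟩
  positivity

/-- **Positive Cheeger constant = a linear isoperimetric inequality**: on a nonempty vertex type,
`h(G) > 0 ↔ ∃ c > 0, ∀ S finite nonempty, c |S| ≤ |∂S|`. [cite: BenjaminiSchramm1996, §2 (p. 73) and Thm. 2 (p. 74)] -/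
theorem vertexCheegerConst_pos_iff [Nonempty V] :
    0 < vertexCheegerConst G ↔
      ∃ c : ℝ, 0 < c ∧ ∀ S : Finset V, S.Nonempty → c * (S.card : ℝ) ≤ ((outerBoundary G S).card : ℝ) := by
  constructor
  · intro h
    refine ⟨vertexCheegerConst G, h, fun S hS => ?_⟩
    have hcard : (0 : ℝ) < S.card := by exact_mod_cast hS.card_pos
    exact (le_div_iff₀ hcard).1 (vertexCheegerConst_le G hS)
  · rintro ⟨c, hc, hle⟩
    refine lt_of_lt_of_le hc (le_csInf ?_ ?_)
    · obtain ⟨v⟩ := ‹Nonempty V›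
      exact ⟨_, {v}, Finset.singleton_nonempty v, rfl⟩
    · rintro _ ⟨S, hS, rfl⟩
      have hcard : (0 : ℝ) < S.card := by exact_mod_cast (show S.Nonempty from hS).card_pos
      exact (le_div_iff₀ hcard).2 (hle S hS)

end Cheeger

/-! ### Isoperimetric inequalities and the isoperimetric dimension `Dim(G)` -/

section Isoperimetric

variable [DecidableEq V] (G : SimpleGraph V) [G.LocallyFinite]

/-- **`d`-dimensional isoperimetric inequality**: there is `c > 0` with `|∂S| ≥ c |S|^{(d-1)/d}` for every finite
nonempty vertex set `S` (`∂S` the outer vertex boundary); equivalently `inf_S |∂S| / |S|^{(d-1)/d} > 0`.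
[cite: BenjaminiSchramm1996, §3 (p. 74, definition of Dim(G))] [cite: DuminilCopinGoswamiRaoufiSeveroYadin2020, §1 (I_d)] -/
def IsoperimetricInequality (d : ℝ) : Prop :=
  ∃ c : ℝ, 0 < c ∧ ∀ S : Finset V, S.Nonempty →
    c * (S.card : ℝ) ^ ((d - 1) / d) ≤ ((outerBoundary G S).card : ℝ)

/-- **The isoperimetric dimension** `Dim(G) = sup {d > 0 : inf_S |∂S| / |S|^{(d-1)/d} > 0} ∈ [0, ∞]`, as an
extended nonnegative real (`⊤` e.g. for graphs with positive Cheeger constant, which satisfy the inequality for every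
`d`; `0` when no `d > 0` qualifies). [cite: BenjaminiSchramm1996, §3 (p. 74)]
[cite: DuminilCopinGoswamiRaoufiSeveroYadin2020, §1 ("the supremum over all d such that (I_d) holds")] -/
def isoperimetricDimension : ℝ≥0∞ :=
  sSup {x : ℝ≥0∞ | ∃ d : ℝ, 0 < d ∧ IsoperimetricInequality G d ∧ x = ENNReal.ofReal d}

variable {G}

/-- Monotonicity in the dimension: the `d`-dimensional inequality implies the `d'`-dimensional one for
`0 < d' ≤ d` (since `|S| ≥ 1` and `(d'-1)/d' ≤ (d-1)/d`), so the set of admissible `d` in `Dim(G) = sup {…}` is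
an initial segment of `(0, ∞)`. [cite: BenjaminiSchramm1996, §3 (p. 74, definition of Dim(G))] -/
theorem IsoperimetricInequality.of_le {d d' : ℝ} (h : IsoperimetricInequality G d) (hd' : 0 < d') (hle : d' ≤ d) :
    IsoperimetricInequality G d' := by
  obtain ⟨c, hc, hS⟩ := h
  refine ⟨c, hc, fun S hSne => le_trans ?_ (hS S hSne)⟩
  have hcard : (1 : ℝ) ≤ S.card := by exact_mod_cast hSne.card_pos
  have hd : 0 < d := lt_of_lt_of_le hd' hle
  have hexp : (d' - 1) / d' ≤ (d - 1) / d := by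
    rw [div_le_div_iff₀ hd' hd]
    nlinarith
  exact mul_le_mul_of_nonneg_left (Real.rpow_le_rpow_of_exponent_le hcard hexp) hc.le

/-- **`Dim(G) > 1` iff `G` satisfies a `d`-dimensional isoperimetric inequality for some `d > 1`** — the form in
which Benjamini–Schramm's Question 2 ("Does `Dim(G) > 1` imply `p_c(G) < 1`?") is typed.
[cite: BenjaminiSchramm1996, §3 (p. 74, Question 2)] -/
theorem one_lt_isoperimetricDimension_iff :
    1 < isoperimetricDimension G ↔ ∃ d : ℝ, 1 < d ∧ IsoperimetricInequality G d := by
  rw [isoperimetricDimension, lt_sSup_iff]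
  constructor
  · rintro ⟨x, ⟨d, hd, hI, rfl⟩, hx⟩
    exact ⟨d, (ENNReal.one_lt_ofReal).1 hx, hI⟩
  · rintro ⟨d, hd, hI⟩
    exact ⟨ENNReal.ofReal d, ⟨d, lt_trans zero_lt_one hd, hI, rfl⟩, (ENNReal.one_lt_ofReal).2 hd⟩

/-- A positive Cheeger constant gives the isoperimetric inequality in EVERY dimension `d > 0`
(`|S|^{(d-1)/d} ≤ |S|` as `|S| ≥ 1`), so `Dim(G) = ∞` for such graphs. [cite: BenjaminiSchramm1996, §3 (p. 74)] -/
theorem isoperimetricInequality_of_vertexCheegerConst_pos [Nonempty V] (h : 0 < vertexCheegerConst G) {d : ℝ}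
    (hd : 0 < d) : IsoperimetricInequality G d := by
  obtain ⟨c, hc, hle⟩ := (vertexCheegerConst_pos_iff G).1 h
  refine ⟨c, hc, fun S hS => le_trans ?_ (hle S hS)⟩
  have hcard : (1 : ℝ) ≤ S.card := by exact_mod_cast hS.card_pos
  refine mul_le_mul_of_nonneg_left ?_ hc.le
  calc (S.card : ℝ) ^ ((d - 1) / d) ≤ (S.card : ℝ) ^ (1 : ℝ) :=
        Real.rpow_le_rpow_of_exponent_le hcard (by rw [div_le_one hd]; linarith)
    _ = S.card := Real.rpow_one _

end Isoperimetric

end Literature.Probability.Percolation
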